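import Summits.NavierStokesRegularity.FluidComputer.GateBudgetCombSharp
import Summits.NavierStokesRegularity.FluidComputer.GateBudgetCombProfile
import HarnessLib

/-!
# What no tuning can beat, part 28: THE STATE OF A MEMBER — every level of parts 19–25 at the
# member's own critical and dousing times, exported ONCE, with Tao's critical window

Cell `pub-fluidc`, blueprint seat bp1 (gen 31, sixth item); same namespace and conventions as
parts 1–27 (`GateBudget*.lean`); imports part 25a (`GateBudgetCombSharp`: the second-order
exit `knob_phase_exit_sharp`, through it parts 16–24a) and part 24b (`GateBudgetCombProfile`:
the window numeric `profile_delta`, through it parts 19–23). Modes `0 = a` input, `1 = b`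
clock, `2 = c` catalyst, `3 = d` transfer, `4 = ã` output; `σ_knob = ρ²/ε`.
HONEST FRAMING (verbatim): low prior, high value-of-information experiment on Tao's machine
paradigm; NOT a claim that NS blows up.

THE POINT. Parts 20–27 are LAWS behind levels at the member's own times `s₀` (critical: the
catalyst reaches `ρ²/K¹⁰`) and `T` (dousing: the clock is reversed to `-ε/4`), and each of
parts 24b/25b re-threads part 19's hundred-line level derivation to discharge them, exporting
only its own conclusion. §80 (`knob_member_levels`) is part 19's `knob_dynamic_levels` with
ONE more export, read off the same hitting time: Tao's critical window
`2 - 24 log K/M ≤ s₀² ≤ 2 + 2/M` (`RotorKnob.tc_window`, (tcable) — in the tree since the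
knob family was typed, never threaded into the `GateBudget` chain). §81 (`knob_member_state`)
adds part 25a's second-order exit at winding number `w` (`ε = wMρ²`, no lattice condition)
and exports the RAW state: the window of `s₀`, `s₀ < T ≤ s₀ + Δ`, `b(T) ≤ -ε/4`,
`c(T) ≤ (K⁻¹⁰ + 4e^{-M}/M)ρ²`, `ã(s₀) ≤ 3/K¹⁰`, `ã(T) ≤ 3/K¹⁰ + KΔ`, and the four exit
brackets `|cos wπ|(1 - ψ²/2) - |sin wπ|ψ - D ≤ |a(T)| ≤ |cos wπ| + |sin wπ|ψ + D`,
`|sin wπ|(1 - ψ²/2) - |cos wπ|ψ - D ≤ |d(T)| ≤ |sin wπ| + |cos wπ|ψ + D`. §82 puts in the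
numbers at `M = K¹⁰` on the window `200ε/K²⁰ ≤ ρ² ≤ 2ε/K¹⁰`: `2 - 24 log K/K¹⁰ ≤ s₀² ≤
2 + 2/K¹⁰`, `T ≤ s₀ + 242/K⁹`, `ã(T) ≤ 10⁻³`, `ψ = 7/100`, `D = 10⁻³`
(`knob_member_state_headline`). Every later law — part 25a's cap, part 27's rise and wait,
a second-pulse exclusion — now bolts onto ONE existential, and because the window of `s₀` is
COMMON to all members (it does not see `ρ`), the member-specific times can be traded for an
instant: part 29.

HONEST LIMITS. (i) No new dynamics: §80 is part 19's proof with `tc_window`'s first two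
conjuncts kept instead of discarded, §81 is part 25b's §75 with the levels exported instead of
consumed. (ii) The window of `s₀` has width `O(log K/M)` below `√2` and `O(1/M)` above; `T`
is pinned to `s₀` within `Δ` (`242/K⁹` at `M = K¹⁰`) — the dousing time is NOT shown to be
monotone in `ρ` (SPEC (6′) as stated stays open; the instant of part 29 comes from the
common window, not from a comparison of trajectories). (iii) `M = K¹⁰` in §82 is Tao's
amplifier; §80–§81 are general. (iv) Nothing about Navier–Stokes: statements about (5.6).
[cite: Tao2016AveragedNS, §5.5 Theorem 5.3, (5.5), (5.6), (b-eq), (c-eq), (tcable)]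
-/

noncomputable section

namespace Summit.NavierStokesRegularity.FluidComputer.GateBudget

open Real Set Filter Topology
open Literature.Analysis.FluidPDE.Tao2016AveragedNS

variable {K M ε ρ : ℝ} {X : ℝ → Fin 5 → ℝ} {C : ℝ → ℝ}

/-! ## §80 The levels of part 19, with the critical window -/

/-- **THE LEVELS, WITH TAO'S CRITICAL WINDOW.** Part 19's `knob_dynamic_levels` verbatim (same
hypotheses, same levels at the critical time `s₀` and the dousing time `T`), with the window
`2 - 24 log K/M ≤ s₀² ≤ 2 + 2/M` of `RotorKnob.tc_window` exported as well: `s₀` IS the first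
hitting time of the level `ρ²/K¹⁰` by the catalyst (part 19's `knob_entry_levels`), at which
(tcable) is read off. The window does not depend on `ρ`: it is common to every member.
[cite: Tao2016AveragedNS, §5.5 Theorem 5.3, (5.5), (5.6), (b-eq), (c-eq), (tcable)] -/
theorem knob_member_levels (hX : ∀ t, HasDerivAt X (RotorKnob.rotorCircuit K M ε ρ (X t)) t)
    (h0 : X 0 = delayInit) (hε : 0 < ε) (hρ : 0 < ρ) (hρε : ρ ^ 2 ≤ ε) (hM : 0 < M)
    (hMK : M ≤ K ^ 10) (hK : 16 ≤ K) (hML : 48 * Real.log K ≤ M)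
    (hεK : ε ^ 2 ≤ 1 / (6 * K ^ 20)) (hMρ : M * ρ ^ 4 ≤ ε ^ 2)
    (hC : ∀ t, HasDerivAt C (X t 2) t)
    (hbig : 8 * log (25 * ε * K ^ 10 / (8 * ρ ^ 2)) / M + 200 / (169 * M - 400) < 1 / 16) :
    ∃ s₀ T : ℝ, 2 - 24 * Real.log K / M ≤ s₀ ^ 2 ∧ s₀ ^ 2 ≤ 2 + 2 / M ∧
      1 ≤ s₀ ∧ s₀ ≤ 3 / 2 ∧ s₀ < T ∧
      T - s₀ ≤ 8 * log (25 * ε * K ^ 10 / (8 * ρ ^ 2)) / M + 200 / (169 * M - 400) ∧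
      (∀ t ∈ Icc s₀ T, 0 < X t 2) ∧
      (∀ t ∈ Icc s₀ T, (7 / 10 * ε) ^ 2 ≤ X t 1 ^ 2 + X t 2 ^ 2) ∧
      ε / 2 ≤ X s₀ 1 ∧ X s₀ 2 = ρ ^ 2 / K ^ 10 ∧ X T 1 ≤ -(ε / 4) ∧
      X T 2 ≤ (1 / K ^ 10 + 4 * exp (-M) / M) * ρ ^ 2 ∧
      |(C s₀ - C 0) / ρ ^ 2| ≤ 3 / (2 * K ^ 10) ∧ X s₀ 4 ≤ 3 / K ^ 10 ∧
      X T 4 ≤ X s₀ 4 + K * (T - s₀) ∧ |X s₀ 0 - 1| ≤ 8 / K ^ 20 ∧ |X s₀ 3| ≤ 3 / K ^ 10 := by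
  have hK0 : 0 < K := by linarith
  have hK10 : 0 < K ^ 10 := by positivity
  have hρ2 : 0 < ρ ^ 2 := by positivity
  have hε2 : 0 < ε ^ 2 := by positivity
  -- `M ≥ 133` from `M ≥ 48 log K ≥ 48 log 16 = 192 log 2`
  have hM133 : 133 ≤ M := by
    have h16 : log 16 = 4 * log 2 := by
      rw [show (16 : ℝ) = 2 ^ 4 by norm_num, Real.log_pow]; norm_num
    have hlogK : log 16 ≤ log K := log_le_log (by norm_num) hK
    linarith [Real.log_two_gt_d9]
  have hMε : 133 * ε ^ 2 ≤ M * ε ^ 2 := mul_le_mul_of_nonneg_right hM133 hε2.le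
  -- §54: entry at the critical time; (tcable): the critical window at the same hitting time
  obtain ⟨s₀, hs₁, hs32, hcle, hcs₀, hbs₀, has₀, hde⟩ :=
    knob_entry_levels hX h0 hε hρ hρε hM hMK hK hML hεK hMρ
  have hs₀ : 0 ≤ s₀ := by linarith
  obtain ⟨hsq1, hsq2, -, -, -⟩ :=
    RotorKnob.tc_window hX h0 hε hρ hρε hM hMK hK hML hεK hMρ (by linarith) (by linarith)
      (fun t ht0 hts => hcle t ⟨ht0, hts⟩) (fun _ => hcs₀)
  have hK20 : (1700 : ℝ) ≤ K ^ 20 := le_trans (by norm_num) (pow_le_pow_left₀ (by norm_num) hK 20)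
  have h17 : 17 * ε / K ^ 20 ≤ ε / 100 := by
    rw [div_le_div_iff₀ (by positivity) (by norm_num)]
    have := mul_le_mul_of_nonneg_left hK20 hε.le
    linarith
  have hb99 : 99 / 100 * ε ≤ X s₀ 1 := by
    have h := (abs_le.1 hbs₀).1
    have h1 := mul_le_mul_of_nonneg_right h17 hs₀
    have h2 := mul_le_mul_of_nonneg_left hs₁ hε.le
    linarith
  -- §55 with `H = 1/16`, `β = ε/4`, `ϱ = 7ε/10`, `γ = 13ε/20`, `λ₁ = λ = K⁻¹⁰`
  have hγε : ε ^ 2 < M * (13 / 20 * ε) ^ 2 := by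
    rw [show M * (13 / 20 * ε) ^ 2 = 169 / 400 * (M * ε ^ 2) by ring]; linarith
  have hγϱ : (13 / 20 * ε) ^ 2 + (ε / 4) ^ 2 ≤ (7 / 10 * ε) ^ 2 := by linarith [hε2]
  have harm : (7 / 10 * ε) ^ 2 + 2 * ε ^ 2 * ((s₀ + 1 / 16) ^ 2 - s₀ ^ 2) ≤
      X s₀ 1 ^ 2 + X s₀ 2 ^ 2 := by
    have hb2 : (99 / 100 * ε) * (99 / 100 * ε) ≤ X s₀ 1 * X s₀ 1 :=
      mul_self_le_mul_self (by positivity) hb99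
    have hs : ε ^ 2 * s₀ ≤ ε ^ 2 * (3 / 2) := mul_le_mul_of_nonneg_left hs32 hε2.le
    linarith [sq_nonneg (X s₀ 2), hb2, hs]
  have hu₁ : 1 / K ^ 10 * ρ ^ 2 ≤ X s₀ 2 := by rw [hcs₀]; apply le_of_eq; ring
  have hden : 0 < M * (13 / 20 * ε) ^ 2 - ε ^ 2 := by
    rw [show M * (13 / 20 * ε) ^ 2 - ε ^ 2 = 169 / 400 * (M * ε ^ 2) - ε ^ 2 by ring]; linarith
  have hΔB : 2 * ε * (ε / 4) / (M * (13 / 20 * ε) ^ 2 - ε ^ 2) = 200 / (169 * M - 400) := by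
    rw [div_eq_div_iff hden.ne' (by linarith : (0:ℝ) < 169 * M - 400).ne']
    ring
  have hx : 2 * ε * (s₀ + 1 / 16) / (1 / K ^ 10 * ρ ^ 2) ≤ 25 * ε * K ^ 10 / (8 * ρ ^ 2) := by
    rw [show 2 * ε * (s₀ + 1 / 16) / (1 / K ^ 10 * ρ ^ 2)
        = 2 * (s₀ + 1 / 16) * (ε * K ^ 10 / ρ ^ 2) by field_simp,
      show 25 * ε * K ^ 10 / (8 * ρ ^ 2) = 25 / 8 * (ε * K ^ 10 / ρ ^ 2) by ring]
    exact mul_le_mul_of_nonneg_right (by linarith) (by positivity)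
  have hlog := log_le_log (by positivity) hx
  have hid : ε * log (2 * ε * (s₀ + 1 / 16) / (1 / K ^ 10 * ρ ^ 2)) / (M * (ε / 4))
      = 4 * (log (2 * ε * (s₀ + 1 / 16) / (1 / K ^ 10 * ρ ^ 2)) / M) := by
    field_simp
  have h8 : 8 * (log (2 * ε * (s₀ + 1 / 16) / (1 / K ^ 10 * ρ ^ 2)) / M)
      ≤ 8 * (log (25 * ε * K ^ 10 / (8 * ρ ^ 2)) / M) :=
    mul_le_mul_of_nonneg_left (div_le_div_of_nonneg_right hlog hM.le) (by norm_num)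
  rw [mul_div_assoc] at hbig
  have hΔ : ε * log (2 * ε * (s₀ + 1 / 16) / (1 / K ^ 10 * ρ ^ 2)) / (M * (ε / 4))
      + 2 * ε * (ε / 4) / (M * (13 / 20 * ε) ^ 2 - ε ^ 2)
      + ε * log (2 * ε * (s₀ + 1 / 16) / (1 / K ^ 10 * ρ ^ 2)) / (M * (ε / 4)) < 1 / 16 := by
    rw [hΔB, hid]; linarith
  obtain ⟨t₁, t₂, T, h01, h12, h2T, hTΔ, hTH, -, -, -, -, hdead, hcT, harmw, hcpos⟩ :=
    knob_pulse_window hX h0 hε hρ hρε hM hs₀ (by norm_num : (0:ℝ) < 1 / 16) (by positivity)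
      (by linarith) (by positivity) hγϱ hγε harm hu₁ (by positivity) le_rfl hΔ
  have hsT : s₀ < T := by linarith
  -- the dose, the output and the exit levels
  have hdose := knob_entry_dose hX h0 hρ hC hs₀ (ℓ := 1 / K ^ 10)
    (fun t ht => by rw [show 1 / K ^ 10 * ρ ^ 2 = ρ ^ 2 / K ^ 10 by ring]; exact hcle t ht)
  have hgrow := knob_output_growth hX h0 hK0.le hsT.le
  have hcT' : X T 2 ≤ (1 / K ^ 10 + 4 * exp (-M) / M) * ρ ^ 2 := by
    rw [show ε * exp (-M) / (M * (ε / 4)) = 4 * exp (-M) / M by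
      rw [div_eq_div_iff (by positivity) hM.ne']; ring] at hcT
    exact hcT
  have hΦ₀ : |(C s₀ - C 0) / ρ ^ 2| ≤ 3 / (2 * K ^ 10) := by
    refine hdose.2.trans ?_
    rw [div_mul_eq_mul_div, one_mul, div_le_div_iff₀ hK10 (by positivity)]
    have := mul_le_mul_of_nonneg_right hs32 hK10.le
    linarith
  refine ⟨s₀, T, hsq1, hsq2, hs₁, hs32, hsT, ?_, fun t ht => hcpos t ⟨ht.1, by linarith [ht.2]⟩,
    fun t ht => harmw t ⟨ht.1, by linarith [ht.2]⟩, by linarith, hcs₀,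
    hdead T ⟨h2T, hTH.le⟩, hcT', hΦ₀, (abs_le.1 (hde s₀ ⟨hs₀, le_rfl⟩).2).2, hgrow, has₀,
    (hde s₀ ⟨hs₀, le_rfl⟩).1⟩
  rw [hΔB, hid] at hTΔ
  rw [mul_div_assoc]
  linarith

/-! ## §81 The state of a member at winding number `w` -/

/-- **THE STATE OF A MEMBER.** Along an exact trajectory of `rotorCircuit K M ε ρ` from (5.6)
with `0 < ρ² ≤ ε`, `Mρ⁴ ≤ ε²`, written `ε = wMρ²` (NO lattice condition), under `16 ≤ K`,
`48 log K ≤ M ≤ K¹⁰`, `ε² ≤ 1/(6K²⁰)` and `(8/M)log(25εK¹⁰/(8ρ²)) + 200/(169M - 400) ≤ Δ <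
1/16`: there are the member's own times `s₀` (critical) and `T` (dousing) with (WINDOW)
`2 - 24 log K/M ≤ s₀² ≤ 2 + 2/M`, `1 ≤ s₀ ≤ 3/2`, `s₀ < T ≤ s₀ + Δ`; (LEVELS) `b(T) ≤ -ε/4`,
`c(T) ≤ (K⁻¹⁰ + 4e^{-M}/M)ρ²`, `ã(s₀) ≤ 3/K¹⁰`, `ã(T) ≤ 3/K¹⁰ + KΔ`; (EXIT) for ANY `ψ ≥` the
phase budget of part 22b (`winding_psi_le`, `κ ≥ w`) and `D ≥` the drift of part 20
(`lattice_drift_le`, `P ≥ ρ²`): `|cos wπ|(1 - ψ²/2) - |sin wπ|ψ - D ≤ |a(T)| ≤ |cos wπ| +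
|sin wπ|ψ + D` and `|sin wπ|(1 - ψ²/2) - |cos wπ|ψ - D ≤ |d(T)| ≤ |sin wπ| + |cos wπ|ψ + D`.
§80 for the window and the levels; part 24a's `knob_winding_phase` (total phase `wπ ± ψ`) and
part 25a's `knob_phase_exit_sharp` for the exit — part 25b's §75 with the state exported.
[cite: Tao2016AveragedNS, §5.5 Theorem 5.3, (5.5), (5.6), (b-eq), (c-eq), (tcable)] -/
theorem knob_member_state
    (hX : ∀ t, HasDerivAt X (RotorKnob.rotorCircuit K M ε ρ (X t)) t)
    (h0 : X 0 = delayInit) (hε : 0 < ε) (hρ : 0 < ρ) (hρε : ρ ^ 2 ≤ ε)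
    (hMρ : M * ρ ^ 4 ≤ ε ^ 2) (hM : 0 < M) (hMK : M ≤ K ^ 10) (hK : 16 ≤ K)
    (hML : 48 * Real.log K ≤ M) (hεK : ε ^ 2 ≤ 1 / (6 * K ^ 20))
    (hC : ∀ t, HasDerivAt C (X t 2) t) (w : ℝ) (hk : ε = w * M * ρ ^ 2)
    {κ P Δ ψ D : ℝ} (hκ : w ≤ κ) (hP : ρ ^ 2 ≤ P)
    (hΔ : 8 * log (25 * ε * K ^ 10 / (8 * ρ ^ 2)) / M + 200 / (169 * M - 400) ≤ Δ)
    (hH : Δ < 1 / 16)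
    (hψ : 6 / (M * K ^ 10) + 16 * exp (-M) / M ^ 2
        + (κ * (π * (100 / (49 * M))) + 10 * exp (-M) * Δ / (7 * M)) / (1 - 100 / (49 * M))
        + 3 / (2 * K ^ 10) ≤ ψ)
    (hD : 6 * (ε + P * exp (-M) + 3 / K ^ 9)
        + 2 * (ε + P * exp (-M) + 3 / K ^ 9 + K ^ 2 * Δ) * Δ ≤ D) :
    ∃ s₀ T : ℝ, 2 - 24 * Real.log K / M ≤ s₀ ^ 2 ∧ s₀ ^ 2 ≤ 2 + 2 / M ∧
      1 ≤ s₀ ∧ s₀ ≤ 3 / 2 ∧ s₀ < T ∧ T - s₀ ≤ Δ ∧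
      X T 1 ≤ -(ε / 4) ∧ X T 2 ≤ (1 / K ^ 10 + 4 * exp (-M) / M) * ρ ^ 2 ∧
      X s₀ 4 ≤ 3 / K ^ 10 ∧ X T 4 ≤ 3 / K ^ 10 + K * Δ ∧
      |X T 0| ≤ |cos (w * π)| + |sin (w * π)| * ψ + D ∧
      |X T 3| ≤ |sin (w * π)| + |cos (w * π)| * ψ + D ∧
      |cos (w * π)| * (1 - ψ ^ 2 / 2) - |sin (w * π)| * ψ - D ≤ |X T 0| ∧
      |sin (w * π)| * (1 - ψ ^ 2 / 2) - |cos (w * π)| * ψ - D ≤ |X T 3| := by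
  have hK0 : 0 < K := by linarith
  have hK1 : 1 ≤ K := by linarith
  have hε2 : 0 < ε ^ 2 := by positivity
  -- the winding number is positive
  have hw' : w = ε / (M * ρ ^ 2) := by
    rw [eq_div_iff (by positivity), hk]; ring
  have hw0 : 0 < w := by rw [hw']; positivity
  have hM133 : 133 ≤ M := by
    have h16 : log 16 = 4 * log 2 := by
      rw [show (16 : ℝ) = 2 ^ 4 by norm_num, Real.log_pow]; norm_num
    have hlogK : log 16 ≤ log K := log_le_log (by norm_num) hK
    linarith [Real.log_two_gt_d9]
  -- §80: the window and the levels at the member's own times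
  obtain ⟨s₀, T, hsq1, hsq2, hs1, hs32, hsT, hTΔ, hcpos, harm, hbs, hcs, hbT, hcT, hΦ, he₀, heT,
      ha₀, hd₀⟩ :=
    knob_member_levels hX h0 hε hρ hρε hM hMK hK hML hεK hMρ hC (lt_of_le_of_lt hΔ hH)
  have hTΔ' : T - s₀ ≤ Δ := hTΔ.trans hΔ
  have hs0 : 0 ≤ s₀ := by linarith
  -- the critical ratio is subunit on the window radius `ϱ = 7ε/10`
  have hq : ε ^ 2 < M * (7 / 10 * ε) ^ 2 := by
    have hMε : 133 * ε ^ 2 ≤ M * ε ^ 2 := mul_le_mul_of_nonneg_right hM133 hε2.le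
    have h49 : M * (7 / 10 * ε) ^ 2 = 49 / 100 * (M * ε ^ 2) := by ring
    rw [h49]; linarith
  -- the closed forms of the phase budget (part 22b) and of the drift (part 20)
  have hψ' := (winding_psi_le w hw0.le hk hκ hε hρ hM133 hK0 hTΔ').trans hψ
  have hD' := (lattice_drift_le hK1 hε.le hP hs0 hs32 (by linarith) hTΔ' he₀ heT).trans hD
  -- part 24a §69: the total phase is `wπ` up to the budget; part 25a §73: the sharp exit
  have hη := knob_swing_lower (b₁ := ε / 2) (γ₁ := ρ ^ 2 / K ^ 10) (β := ε / 4)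
    (lam₀ := 1 / K ^ 10 + 4 * exp (-M) / M) (by positivity) hbs (hcpos s₀ ⟨le_rfl, hsT.le⟩)
    hcs.le (by positivity) hbT (hcpos T ⟨hsT.le, le_rfl⟩) hcT
  have hph := knob_winding_phase hX h0 hε hρ hM hC w hw0.le hk hsT.le (by positivity) hq hcpos
    harm hη hΦ
  obtain ⟨⟨hd1, hd2⟩, ha1, ha2⟩ :=
    knob_phase_exit_sharp hX h0 hC hε.le hK0.le hs0 hsT.le (hph.trans hψ')
  -- the output at the dousing time: `ã(T) ≤ ã(s₀) + K(T - s₀) ≤ 3/K¹⁰ + KΔ`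
  have heT' : X T 4 ≤ 3 / K ^ 10 + K * Δ := by
    have := mul_le_mul_of_nonneg_left hTΔ' hK0.le
    linarith
  exact ⟨s₀, T, hsq1, hsq2, hs1, hs32, hsT, hTΔ', hbT, hcT, he₀, heT', by linarith, by linarith,
    by linarith, by linarith⟩

/-! ## §82 The state of a member at Tao's amplifier `M = K¹⁰` -/

/-- **THE STATE OF A MEMBER AT `M = K¹⁰`.** For `K ≥ 16`, `0 < ε`, `ε² ≤ 1/(6K²⁰)` and an
exact trajectory of `rotorCircuit K K¹⁰ ε ρ` from (5.6) with `200ε/K²⁰ ≤ ρ² ≤ 2ε/K¹⁰` (winding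
number `w = ε/(K¹⁰ρ²)` between `1/2` and `K¹⁰/200`, no lattice condition) there are its own
times with (WINDOW) `2 - 24 log K/K¹⁰ ≤ s₀² ≤ 2 + 2/K¹⁰`, `1 ≤ s₀ ≤ 3/2`,
`s₀ < T ≤ s₀ + 242/K⁹`; (LEVELS) `b(T) ≤ -ε/4`, `c(T) ≤ (K⁻¹⁰ + 4e^{-K¹⁰}/K¹⁰)ρ²`,
`ã(T) ≤ 10⁻³`; (EXIT) with `c = |cos wπ|`, `s = |sin wπ|`:
`0.99755c - 0.07s - 10⁻³ ≤ |a(T)| ≤ c + 0.07s + 10⁻³` and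
`0.99755s - 0.07c - 10⁻³ ≤ |d(T)| ≤ s + 0.07c + 10⁻³` — §81 at `M = K¹⁰`, `Δ = 242/K⁹`
(`profile_delta`), `ψ = 7/100` (`teeth_psi` at `κ = 2w`; `1 - ψ²/2 = 19951/20000`), `D = 10⁻³`
(`headline_drift`), `48 log K ≤ K¹⁰` (`headline_trigger`), and `3/K¹⁰ + 242/K⁸ ≤ 10⁻³`. These
are exactly the hypotheses of part 25a's cap and of part 27's rise and wait.
[cite: Tao2016AveragedNS, §5.5 Theorem 5.3, (5.5), (5.6), (b-eq), (c-eq), (tcable)] -/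
theorem knob_member_state_headline {K ε ρ : ℝ} {X : ℝ → Fin 5 → ℝ} {C : ℝ → ℝ}
    (hX : ∀ t, HasDerivAt X (RotorKnob.rotorCircuit K (K ^ 10) ε ρ (X t)) t)
    (h0 : X 0 = delayInit) (hC : ∀ t, HasDerivAt C (X t 2) t) (hK : 16 ≤ K) (hε : 0 < ε)
    (hεK : ε ^ 2 ≤ 1 / (6 * K ^ 20)) (hρ : 0 < ρ) (hlo : 200 * ε / K ^ 20 ≤ ρ ^ 2)
    (hhi : K ^ 10 * ρ ^ 2 ≤ 2 * ε) :
    ∃ s₀ T : ℝ, 2 - 24 * Real.log K / K ^ 10 ≤ s₀ ^ 2 ∧ s₀ ^ 2 ≤ 2 + 2 / K ^ 10 ∧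
      1 ≤ s₀ ∧ s₀ ≤ 3 / 2 ∧ s₀ < T ∧ T - s₀ ≤ 242 / K ^ 9 ∧
      X T 1 ≤ -(ε / 4) ∧ X T 2 ≤ (1 / K ^ 10 + 4 * exp (-K ^ 10) / K ^ 10) * ρ ^ 2 ∧
      X T 4 ≤ 1 / 1000 ∧
      |X T 0| ≤ |cos (ε / (K ^ 10 * ρ ^ 2) * π)|
          + 7 / 100 * |sin (ε / (K ^ 10 * ρ ^ 2) * π)| + 1 / 1000 ∧
      |X T 3| ≤ |sin (ε / (K ^ 10 * ρ ^ 2) * π)|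
          + 7 / 100 * |cos (ε / (K ^ 10 * ρ ^ 2) * π)| + 1 / 1000 ∧
      19951 / 20000 * |cos (ε / (K ^ 10 * ρ ^ 2) * π)|
          - 7 / 100 * |sin (ε / (K ^ 10 * ρ ^ 2) * π)| - 1 / 1000 ≤ |X T 0| ∧
      19951 / 20000 * |sin (ε / (K ^ 10 * ρ ^ 2) * π)|
          - 7 / 100 * |cos (ε / (K ^ 10 * ρ ^ 2) * π)| - 1 / 1000 ≤ |X T 3| := by
  have hK0 : 0 < K := by linarith
  have hK10 : 0 < K ^ 10 := by positivity
  have h8 : (4294967296 : ℝ) ≤ K ^ 8 := by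
    have := headline_pow_floor hK 8; norm_num at this; exact this
  have h9 : (68719476736 : ℝ) ≤ K ^ 9 := by
    have := headline_pow_floor hK 9; norm_num at this; exact this
  have h10 : (1099511627776 : ℝ) ≤ K ^ 10 := by
    have := headline_pow_floor hK 10; norm_num at this; exact this
  have hH : (242 : ℝ) / K ^ 9 < 1 / 16 := by
    rw [div_lt_div_iff₀ (by positivity) (by norm_num)]; linarith [h9]
  have hΔ0 : (0 : ℝ) ≤ 242 / K ^ 9 := by positivity
  -- the member's winding number `w = ε/(K¹⁰ρ²) ≤ κ := 2w`, and `20ε/K²⁰ ≤ 200ε/K²⁰ ≤ ρ²`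
  have hk : ε = ε / (K ^ 10 * ρ ^ 2) * K ^ 10 * ρ ^ 2 := by
    field_simp
  have hκ : ε / (K ^ 10 * ρ ^ 2) ≤ 2 * ε / (K ^ 10 * ρ ^ 2) :=
    div_le_div_of_nonneg_right (by linarith) (by positivity)
  have hlo20 : 20 * ε / K ^ 20 ≤ ρ ^ 2 :=
    le_trans (div_le_div_of_nonneg_right (by linarith) (by positivity)) hlo
  -- `ρ² ≤ 2ε/K¹⁰ ≤ ε` and `K¹⁰ρ⁴ ≤ 2ερ² ≤ 4ε²/K¹⁰ ≤ ε²`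
  have hρε : ρ ^ 2 ≤ ε := by nlinarith [sq_nonneg ρ]
  have hMρ : K ^ 10 * ρ ^ 4 ≤ ε ^ 2 := by
    have h1 : K ^ 10 * ρ ^ 4 = (K ^ 10 * ρ ^ 2) * ρ ^ 2 := by ring
    have h2 : K ^ 10 * ρ ^ 4 ≤ 2 * ε * ρ ^ 2 := by
      rw [h1]; exact mul_le_mul_of_nonneg_right hhi (sq_nonneg ρ)
    have h3 : K ^ 10 * (2 * ε * ρ ^ 2) ≤ 2 * ε * (2 * ε) := by nlinarith
    nlinarith
  -- the numerics of parts 21 and 23: `ψ = 7/100`, `D = 10⁻³`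
  have hψ := teeth_psi hK hε hlo hΔ0 (by linarith : (242 : ℝ) / K ^ 9 ≤ 1)
  have hD := headline_drift hK hεK hhi
  obtain ⟨s₀, T, hsq1, hsq2, hs1, hs2, hsT, hTs, hbT, hcT, -, heT, ha1, hd1, ha2, hd2⟩ :=
    knob_member_state hX h0 hε hρ hρε hMρ hK10 le_rfl hK (headline_trigger hK) hεK hC
      (ε / (K ^ 10 * ρ ^ 2)) hk (P := ρ ^ 2) hκ le_rfl (profile_delta hK hε hρ hlo20) hH hψ hD
  have e2 : (1 - (7 / 100 : ℝ) ^ 2 / 2) = 19951 / 20000 := by norm_num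
  rw [e2] at ha2 hd2
  -- the output at the dousing time: `3/K¹⁰ + K·242/K⁹ = 3/K¹⁰ + 242/K⁸ ≤ 10⁻³`
  have heT' : X T 4 ≤ 1 / 1000 := by
    have h1 : K * (242 / K ^ 9) = 242 / K ^ 8 := by
      field_simp
    have h2 : (3 : ℝ) / K ^ 10 ≤ 3 / 1099511627776 :=
      div_le_div_of_nonneg_left (by norm_num) (by norm_num) h10
    have h3 : (242 : ℝ) / K ^ 8 ≤ 242 / 4294967296 :=
      div_le_div_of_nonneg_left (by norm_num) (by norm_num) h8
    rw [h1] at heT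
    linarith
  exact ⟨s₀, T, hsq1, hsq2, hs1, hs2, hsT, hTs, hbT, hcT, heT', by linarith, by linarith,
    by linarith, by linarith⟩

end Summit.NavierStokesRegularity.FluidComputer.GateBudget
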